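import Summits.CriticalPhenomena.SAWScalingLimit.Theses.SAWTurnDefect
import Literature.Probability.RandomPlanarGeometry.DrivingFunctionMeasurable

/-!
# Birth skeleton (`Lines/birth.lean`) for crux `FlowLinePassage` (stmt-CriticalPhenomena-7893)

Route `SAWTurnDefect` of `CriticalPhenomena/SAWScalingLimit`, crux r5

  `FlowLinePassage := HexFlowLineMartingale → ∀ (D; a_δ, b_δ) ∀ s_n → 0⁺ ∀ μ (probability weak
   limit of the hexagonal SAW curve laws along s_n) ∀ φ (chordal uniformizer, μ-a.e. describable):
   the time-limited κ = 8/3 imaginary-geometry observable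
   H_t(z) = arg(g_{t∧T_z}(z) − W_{t∧T_z}) + (1/3)·arg g′_{t∧T_z}(z), T_z = (Im z)²/9,
   W = drivingFunction φ, satisfies the cylinder identities E_μ[(H_{t′} − H_{s′}) ψ(W_S)] = 0`.

## The line — the route header's foreseen split, typed on the tree's KS/CDHKS passage pipeline

`FlowLinePassage ⇐ HexChordalLoewnerData → LatticeIGDefectVanishes → IGCylinderPassage`.

The cylinder functional `Φ(c) = (H_{t′}(z) − H_{s′}(z))·ψ(W_{S₁}, …, W_{Sₙ})` depends on the curve
class `c` ONLY through its driving path `W(c) ∈ C([0, ∞), ℝ)` (`igCyl … (drivingFunction φ c)`),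
and — because of the time limit `T_z = (Im z)²/9 < (Im z)²/4` (no swallowing, `Im g_t(z) ≥ √5/3·Im z`,
`|arg g_t′(z)| ≤ 2/5`) — it is a BOUNDED CONTINUOUS functional of the driving path. It is NOT a
continuous functional of the curve (fjords / near-bubbles change capacities and `g_t` by `O(1)`
under `o(1)` sup-norm perturbations), so the passage of the lattice identity (KC) to a weak limit
`μ` needs convergence IN LAW OF THE DRIVING PROCESSES, i.e. Kemppainen–Smirnov regularity of the
lattice curves — the input the tree's FK/spin-Ising pipelines take as "lattice data"
(`ae_isLoewnerDescribable_and_tendstoInDistribution_of_regularCurves(_varying)`,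
`Loewner.integral_cylinder_eq_zero_of_tendstoInDistribution`). One lattice subtlety is made
explicit: the endpoint approximation `a_δ, b_δ` (`IsEmbEndpointApprox`) is NOT on `∂D`, and the raw
SAW polyline back-loops around `a_δ` with probability bounded below, so its own Loewner transform
through `φ` is junk with non-vanishing probability; the lattice-side driving process is therefore
that of a CHORDAL MODIFICATION `Y δ γ` of the lattice curve (boundary arcs `a → a_δ`, `b_δ → b`
attached in `D ∖ γ`, describable through the FIXED map `φ`), sup-close to `γ.curve` in probability
— the predicate `IsChordalModification` below (closeness in probability, describability in
probability, convergence in distribution of the driving paths along every sequence of meshes on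
which the curve laws converge weakly).

* `stub_hexChordalLoewnerData : HexChordalLoewnerData` (open; the KS engine) — for every Dobrushin
  domain, hexagonal endpoint approximation and chordal uniformizer `φ` there is a chordal
  modification `Y` of the critical hexagonal SAW curve with `IsChordalModification D a b φ Y`:
  Kemppainen–Smirnov regularity of the (modified) critical hexagonal SAW (Condition G2 — open, the
  engine shared with crux r6 `HexLimitsDescribable`) fed into the tree's PROVED KS Thm 1.5(ii)–(iii)
  (`ae_isLoewnerDescribable_and_tendstoInDistribution_of_regularCurves`).
* `stub_latticeIGDefectVanishes : LatticeIGDefectVanishes` (XL, HARDEST — the lattice analysis,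
  where KC is consumed) — `HexFlowLineMartingale` ⇒ for every chordal modification `Y` as above
  and every `z ∈ ℍ`, `s′ ≤ t′`, `S ≤ s′`, continuous `|ψ| ≤ 1`: the CONTINUUM cylinder functional
  of the lattice driving process has vanishing expectation as `δ → 0⁺`,
  `∫ igCyl z s′ t′ S ψ (W(Y δ γ)) d hexSAWLaw_δ → 0`. Content (the crux docstring's list):
  convergence of the discrete harmonic extension `M_t(x_δ)` of the ℍ-winding bank data to
  `(π/2)(1 − 𝔥)`, i.e. `M ≈ A + B·igFun(W(Y))` pathwise on KS-regular curves (harmonic measure ×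
  winding on rough lattice slits, Beurling control of fjords), uniform integrability of the stopped
  `M` (bank data carry the unbounded lattice winding), identification of the effective bank
  constant (`ρ = 0`), and the conversion of KC's identities at DETERMINISTIC lattice times (plus the
  approach-to-`z₀` stopping time) into identities at capacity times (tightness of the normalised
  lattice clock + time change in the limit, or a prefix-stopping-rule upgrade of KC from the exact
  domain Markov property of `x_c^{|γ|}`).
* `stub_igCylinderPassage : IGCylinderPassage` (L, provable now modulo Loewner bookkeeping) — the
  passage: for a chordal modification `Y` with `IsChordalModification D a b φ Y`, a sequence
  `s_n → 0⁺`, a probability weak limit `μ` of the curve laws along `s_n`, if the lattice cylinder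
  expectations tend to `0` as `δ → 0⁺` then `∫ igCyl z s′ t′ S ψ (W c) dμ = 0`. Proof plan: shift the
  sequence into the range where the laws are probability measures (`IsEmbEndpointApprox.reachable`,
  `SAW.isProbabilityMeasure_hexSAWLaw`), use the convergence-in-distribution clause, the continuity
  and boundedness of `W ↦ igCyl … W` on `C([0, ∞), ℝ)` (driver stability of `Loewner.map` and of its
  `z`-derivative below the time limit, `ObservableDriverContinuity.lean`-type estimates; `arg` on
  `{Im > 0}` and on `{Re > 0}`), portmanteau, uniqueness of limits.
* `FlowLinePassage_of` (kernel-checked, no `sorry`): pick `Y` (stub R), feed KC to stub A, conclude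
  with stub P — the crux BY NAME (its `let H` is `igFun … (drivingFunction φ c)` definitionally).

## Disproof / negatives used
* `Cruxes/FlowLinePassage/`: no workfiles at registration (`ledger crux ls stmt-CriticalPhenomena-7893`,
  2026-08-17) — no `Disproof.lean`, no `_false_without_` obstruction to honour.
* `ledger negatives --problem CriticalPhenomena`: the SAW entries (stmt-0772 all-`δ` tightness,
  stmt-5420, stmt-8261, stmt-8312) are not touched — no tightness for all `δ`, no lattice observable
  VALUE and no exact vertex relation is asserted by any stub; closeness / describability are asked
  only in probability and only eventually in `δ`.
-/

noncomputable section

open MeasureTheory Filter Topology Set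
open scoped NNReal ENNReal BoundedContinuousFunction
open UpperHalfPlane (upperHalfPlaneSet)
open Literature.Probability.RandomPlanarGeometry Literature.Probability.LatticeModels
open Summit.CriticalPhenomena.SAWScalingLimit.Theses.SAWTurnDefect (HexFlowLineMartingale)
open scoped Literature.Probability.RandomPlanarGeometry.PathBorel

namespace Summit.CriticalPhenomena.SAWScalingLimit.Cruxes.FlowLinePassage.Birth

/-! ### 1. Vocabulary: the time-limited imaginary-geometry functional of a driving path -/

/-- **The time-limited κ = 8/3 imaginary-geometry functional of a driving path** `W`:
`igFun t z W = arg(g_{t∧T_z}(z) − W_{t∧T_z}) + (1/3)·arg g′_{t∧T_z}(z)`, `T_z = (Im z)²/9`,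
`g = Loewner.map W` — VERBATIM the body of the `let H` of the crux (and of
`SAWImaginaryGeometry.IGMartingaleLimit`, `IGDrivingMartingales`) with `drivingFunction φ c`
abstracted to `W`: `H c t z = igFun t z (drivingFunction φ c)` definitionally. Equals
`(π/2)(1 − 𝔥_t(z))` for Miller–Sheffield's `𝔥` (λ = 1, `πχ/(2λ) = 1/3` at κ = 8/3). -/
def igFun (t : ℝ≥0) (z : ℂ) (W : ℝ≥0 → ℝ) : ℝ :=
  Complex.arg (Loewner.map W (min t (z.im ^ 2 / 9).toNNReal) z -
      (W (min t (z.im ^ 2 / 9).toNNReal) : ℂ)) +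
    (1 / 3 : ℝ) * Complex.arg (deriv (Loewner.map W (min t (z.im ^ 2 / 9).toNNReal)) z)

/-- **The cylinder functional** of the line: `igCyl z s′ t′ S ψ W = (igFun t′ z W − igFun s′ z W) ·
ψ(W(S₁), …, W(Sₙ))` — the integrand of the crux's conclusion as a functional of the driving path
alone. -/
def igCyl (z : ℂ) (s' t' : ℝ≥0) {n : ℕ} (S : Fin n → ℝ≥0) (ψ : (Fin n → ℝ) → ℝ) (W : ℝ≥0 → ℝ) :
    ℝ :=
  (igFun t' z W - igFun s' z W) * ψ (fun k ↦ W (S k))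

/-- **Chordal modification with convergent driving processes.** For the critical hexagonal SAW of
`(D; a_δ, b_δ)` (`SAW.hexSAWLaw`) and a chordal uniformizer `φ` of `(D; a, b)`, the maps
`Y δ : HexDomainSAW D δ a_δ b_δ → CurveClass ℂ` are a chordal modification of the lattice curve with
convergent Loewner transforms: (i) `Y δ γ` is sup-close to `γ.curve` in probability as `δ → 0⁺`;
(ii) `Y δ γ` is Loewner-describable through `φ` with probability `→ 1`; (iii) along EVERY sequence of
meshes `s_n → 0⁺` on which the laws are probability measures and the curve laws converge weakly to a
probability `μ`, the driving paths `W(Y (s n) γ) ∈ C([0, ∞), ℝ)` converge in distribution to the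
driving path `W(c)` of `c ∼ μ` through `φ` (Kemppainen–Smirnov Thm 1.5(iii)/Cor 1.7 in output form,
`ae_isLoewnerDescribable_and_tendstoInDistribution_of_regularCurves`). The modification is needed
because `a_δ, b_δ ∉ ∂D` (`IsEmbEndpointApprox`): the raw polyline is not chordal and back-loops
around `a_δ` with non-vanishing probability. -/
def IsChordalModification (D : DobrushinDomain) (a b : ℝ → HexVertex)
    (φ : ConformalEquiv upperHalfPlaneSet D.carrier)
    (Y : ∀ δ : ℝ, SAW.HexDomainSAW D.carrier δ (a δ) (b δ) → CurveClass ℂ) : Prop :=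
  (∀ ε : ℝ, 0 < ε → ∀ᶠ δ : ℝ in 𝓝[>] (0 : ℝ),
      SAW.hexSAWLaw D.carrier δ (a δ) (b δ) {γ | ε < dist (Y δ γ) γ.curve} ≤ ENNReal.ofReal ε) ∧
  (∀ ε : ℝ, 0 < ε → ∀ᶠ δ : ℝ in 𝓝[>] (0 : ℝ),
      SAW.hexSAWLaw D.carrier δ (a δ) (b δ) {γ | ¬ IsLoewnerDescribable φ (Y δ γ)} ≤
        ENNReal.ofReal ε) ∧
  ∀ (s : ℕ → ℝ) (μ : Measure (CurveClass ℂ))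
    [∀ n, IsProbabilityMeasure (SAW.hexSAWLaw D.carrier (s n) (a (s n)) (b (s n)))]
    [IsProbabilityMeasure μ],
    Tendsto s atTop (𝓝[>] (0 : ℝ)) →
    (∀ f : CurveClass ℂ →ᵇ ℝ, Tendsto (fun n ↦ ∫ γ, f γ.curve
        ∂(SAW.hexSAWLaw D.carrier (s n) (a (s n)) (b (s n)))) atTop (𝓝 (∫ x, f x ∂μ))) →
    TendstoInDistribution
      (fun (n : ℕ) (γ : SAW.HexDomainSAW D.carrier (s n) (a (s n)) (b (s n))) ↦
        (⟨drivingFunction φ (Y (s n) γ), continuous_drivingFunction φ (Y (s n) γ)⟩ : C(ℝ≥0, ℝ)))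
      atTop (fun c ↦ (⟨drivingFunction φ c, continuous_drivingFunction φ c⟩ : C(ℝ≥0, ℝ)))
      (fun n ↦ SAW.hexSAWLaw D.carrier (s n) (a (s n)) (b (s n))) μ

/-! ### 2. The three stub statements -/

/-- STUB R statement — **chordal Loewner data for the critical hexagonal SAW** (Kemppainen–Smirnov
regularity, the open engine): every Dobrushin domain with a hexagonal endpoint approximation and a
chordal uniformizer `φ` admits a chordal modification of the critical SAW curve with convergent
driving processes, `IsChordalModification D a b φ Y`. -/
def HexChordalLoewnerData : Prop :=
  ∀ (D : DobrushinDomain) (a b : ℝ → HexVertex), SAW.IsEmbEndpointApprox hexGraph hexCenter D a b →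
    ∀ φ : ConformalEquiv upperHalfPlaneSet D.carrier, D.IsChordalUniformizing φ →
      ∃ Y : ∀ δ : ℝ, SAW.HexDomainSAW D.carrier δ (a δ) (b δ) → CurveClass ℂ,
        IsChordalModification D a b φ Y

/-- STUB A statement — **the lattice IG cylinder defect vanishes** (the lattice analysis; consumes
KC = `HexFlowLineMartingale`): for every chordal modification `Y` with convergent driving processes
and every `z ∈ ℍ`, `s′ ≤ t′`, earlier times `S ≤ s′` and continuous `|ψ| ≤ 1`, the continuum
cylinder functional of the lattice driving process has vanishing `hexSAWLaw_δ`-expectation as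
`δ → 0⁺`. -/
def LatticeIGDefectVanishes : Prop :=
  HexFlowLineMartingale →
    ∀ (D : DobrushinDomain) (a b : ℝ → HexVertex), SAW.IsEmbEndpointApprox hexGraph hexCenter D a b →
      ∀ φ : ConformalEquiv upperHalfPlaneSet D.carrier, D.IsChordalUniformizing φ →
        ∀ Y : ∀ δ : ℝ, SAW.HexDomainSAW D.carrier δ (a δ) (b δ) → CurveClass ℂ,
          IsChordalModification D a b φ Y →
          ∀ z : ℂ, 0 < z.im → ∀ s' t' : ℝ≥0, s' ≤ t' → ∀ (n : ℕ) (S : Fin n → ℝ≥0), (∀ k, S k ≤ s') →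
            ∀ ψ : (Fin n → ℝ) → ℝ, Continuous ψ → (∀ v, |ψ v| ≤ 1) →
              Tendsto (fun δ : ℝ ↦ ∫ γ, igCyl z s' t' S ψ (drivingFunction φ (Y δ γ))
                ∂(SAW.hexSAWLaw D.carrier δ (a δ) (b δ))) (𝓝[>] (0 : ℝ)) (𝓝 0)

/-- STUB P statement — **passage of the cylinder identity to the weak limit**: for a chordal
modification `Y` with convergent driving processes, a sequence of meshes `s_n → 0⁺` and a
probability weak limit `μ` of the curve laws along `s_n`, vanishing lattice cylinder expectations
give the cylinder identity under `μ`. -/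
def IGCylinderPassage : Prop :=
  ∀ (D : DobrushinDomain) (a b : ℝ → HexVertex), SAW.IsEmbEndpointApprox hexGraph hexCenter D a b →
    ∀ φ : ConformalEquiv upperHalfPlaneSet D.carrier, D.IsChordalUniformizing φ →
      ∀ Y : ∀ δ : ℝ, SAW.HexDomainSAW D.carrier δ (a δ) (b δ) → CurveClass ℂ,
        IsChordalModification D a b φ Y →
        ∀ (s : ℕ → ℝ) (μ : Measure (CurveClass ℂ)), Tendsto s atTop (𝓝[>] (0 : ℝ)) →
          IsProbabilityMeasure μ →
          (∀ f : CurveClass ℂ →ᵇ ℝ, Tendsto (fun n ↦ ∫ γ, f γ.curve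
            ∂(SAW.hexSAWLaw D.carrier (s n) (a (s n)) (b (s n)))) atTop (𝓝 (∫ x, f x ∂μ))) →
          ∀ z : ℂ, 0 < z.im → ∀ s' t' : ℝ≥0, s' ≤ t' → ∀ (n : ℕ) (S : Fin n → ℝ≥0), (∀ k, S k ≤ s') →
            ∀ ψ : (Fin n → ℝ) → ℝ, Continuous ψ → (∀ v, |ψ v| ≤ 1) →
              Tendsto (fun δ : ℝ ↦ ∫ γ, igCyl z s' t' S ψ (drivingFunction φ (Y δ γ))
                ∂(SAW.hexSAWLaw D.carrier δ (a δ) (b δ))) (𝓝[>] (0 : ℝ)) (𝓝 0) →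
              ∫ c, igCyl z s' t' S ψ (drivingFunction φ c) ∂μ = 0

/-! ### 3. The registered stubs (the only `sorry`s of the file) -/

/-- STUB R (open — Kemppainen–Smirnov regularity / Condition G2 for the critical hexagonal SAW,
engine shared with `HexLimitsDescribable`): chordal Loewner data exist. Why plausibly true: for the
modified chordal curve, Condition G2 is the standard conjecture-level input (KS17 §4 verifies it for
FK, percolation, harmonic explorer, LERW); the deterministic half (regular curves ⇒ convergence in
law of driving processes) is PROVED in the tree. Why it might fail: no unforced annulus-crossing
bound for the x_c-SAW is known (sub-ballisticity, arXiv:2310.17299, is the strongest input). -/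
theorem stub_hexChordalLoewnerData : HexChordalLoewnerData := by
  sorry

/-- STUB A (XL, HARDEST): KC ⇒ the lattice IG cylinder defect vanishes. Why it might fail:
KC controls the observable only at DETERMINISTIC lattice times (and at the approach-to-`z₀`
stopping time), while capacity times are random lattice times — the conversion needs tightness of
the normalised lattice clock or a stopping-rule upgrade of KC; and harmonic measure from `z` may
charge lattice fjords where lattice and continuum winding differ by `O(1)` (the crux's own risk). -/
theorem stub_latticeIGDefectVanishes : LatticeIGDefectVanishes := by
  sorry

/-- STUB P (L): passage to the weak limit. Why plausibly true: the cylinder functional is a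
bounded continuous functional of the driving path below the time limit `T_z = (Im z)²/9`
(`Im g_t(z) ≥ √5/3·Im z`, `|arg g_t′(z)| ≤ 2/5`), and the driving paths converge in distribution
by clause (iii) of `IsChordalModification`; why it might fail: only through the junk conventions of
`Loewner.map` / `deriv` at non-continuous paths, which carry measure zero here. -/
theorem stub_igCylinderPassage : IGCylinderPassage := by
  sorry

/-! ### Name-keyed aliases of the stub statements (hypotheses of the composition)

`Registered.stub_X : Prop` is the statement of `stub_X` under the registered stub's short name, so
that the skeleton audit (`#h21_check_skeleton`: hypotheses admissible iff registered stubs BY NAME)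
accepts `FlowLinePassage_of : Registered.stub_… → … → FlowLinePassage` (device of
`Cruxes/ChainLaw/Lines/birth.lean`, `Cruxes/DrivingIdentification/Lines/birth.lean`). -/
namespace Registered

/-- Alias keyed by the registered stub name. -/
abbrev stub_hexChordalLoewnerData : Prop := HexChordalLoewnerData
/-- Alias keyed by the registered stub name. -/
abbrev stub_latticeIGDefectVanishes : Prop := LatticeIGDefectVanishes
/-- Alias keyed by the registered stub name. -/
abbrev stub_igCylinderPassage : Prop := IGCylinderPassage

end Registered

/-! ### 4. The composition (kernel-checked, no `sorry`) -/

/-- **The three stubs imply the crux `FlowLinePassage` BY NAME.** Given KC, a Dobrushin domain with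
hexagonal endpoint approximation, a sequence of meshes `s_n → 0⁺`, a probability weak limit `μ` of
the curve laws and a chordal uniformizer `φ`: take chordal Loewner data `Y` (stub R); the lattice
cylinder expectations of the driving processes of `Y` vanish as `δ → 0⁺` (stub A, fed with KC); pass
to the limit (stub P). The crux's `let H` is `igFun … (drivingFunction φ c)` by `rfl`. (The a.e.
describability hypothesis of the crux is not needed by this line: convergence in law of the driving
processes already carries it.) -/
theorem FlowLinePassage_of (hR : Registered.stub_hexChordalLoewnerData)
    (hA : Registered.stub_latticeIGDefectVanishes) (hP : Registered.stub_igCylinderPassage) :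
    Summit.CriticalPhenomena.SAWScalingLimit.Theses.SAWTurnDefect.FlowLinePassage := by
  intro hKC D a b hab s μ hs hμ hlim φ hφ _hdesc
  obtain ⟨Y, hY⟩ := hR D a b hab φ hφ
  intro H z hz s' t' hst n S hS ψ hψc hψb
  exact hP D a b hab φ hφ Y hY s μ hs hμ hlim z hz s' t' hst n S hS ψ hψc hψb
    (hA hKC D a b hab φ hφ Y hY z hz s' t' hst n S hS ψ hψc hψb)

/-- Wiring check: the registered stubs feed `FlowLinePassage_of` as stated. -/
example : Summit.CriticalPhenomena.SAWScalingLimit.Theses.SAWTurnDefect.FlowLinePassage :=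
  FlowLinePassage_of stub_hexChordalLoewnerData stub_latticeIGDefectVanishes stub_igCylinderPassage

end Summit.CriticalPhenomena.SAWScalingLimit.Cruxes.FlowLinePassage.Birth

end
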